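import Literature.Analysis.FluidPDE.PeriodicSwirlEnergy
import Literature.Analysis.FluidPDE.PeriodicSlabSobolev
import Literature.Analysis.FluidPDE.LeiZhang2011MoserStep
import HarnessLib

/-!
# Lei–Ren–Zhang 2019, proof of Lemma 2.1: one step of the Moser iteration per period

Analysis/FluidPDE proofs file (theorems only, no definitions, no named facts), on the discharge
path of the named fact `Literature.Analysis.FluidPDE.leiRenZhang2019_liouville_periodic`
(Z. Lei, X. Ren, Q. S. Zhang, arXiv:1902.11229 = Math. Ann. 383 (2022), Theorem 1.1). Lemma 2.1
(arXiv pp. 5–6) is the local maximum estimate on the periodic cylinders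
`P_R = D_R × (−R², 0]`, `D_R = {r < R} × [0, Z₀)`: "`sup_{P_{R/2}} |Φ| ≤ C {R⁻⁴ ∬_{P_R} |Φ|²}^{1/2}`,
where the constant `C` does not depend on `R`", proved by "Moser's iteration technique with
adaptations to our periodic setting": the energy inequality (2.8) per period, the Sobolev
inequality per period (2.9) and "Hölder's inequality and Sobolev imbedding theorem … the
`L² − L^{10/3}` estimate".

This file is the analytic core of one step, the periodic twin of the tree's
`LeiZhang2011.reverse_holder_step`: for the tested quantity `H(Λ)` (general convex `H` with
`H'² ≤ κHH″` and a `C¹` square root `s_H`, as in the Lei–Zhang chain; `H(Λ) = Λ²` in print) on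
nested periodic cylinders `(−T₂, 0) × (slab ∩ {r ≤ r₂}) ⊂ (−T₁, 0] × ([0,P] × {r ≤ r₁})`,

`∬_{(−T₂,0)×(slab ∩ {r ≤ r₂})} H(Λ)^{5/3} ≤ K_step · (∬_{(−T₁,0]×([0,P]×{r ≤ r₁})} H(Λ))^{5/3}`,

`K_step = 6 M^{2/3} C_S² c₁^{2/3} (2c₁ + 2D² + (C₀/(MP))²)`, `c₁ = 4κ(1 + C_Φ²)D² + D′`
(`D`, `D′` the gradient bounds of the cut-offs, `C_Φ` the bound of the angular stream potential,
`C_S` the Sobolev constant, `C₀`, `M` the constant and the number of periods of the slab Sobolev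
inequality `PeriodicSlabSobolev`, `κ` the structure constant of `H`). Assembled from
`LeiRenZhang2019.energy_inequality_periodic` (applied on `[−T₁, t]` for every `t ≤ 0`), the
tree's `LeiZhang2011.sup_le_and_integral_le_of_energy_ineq`, the slab interpolation inequality
(hypothesis `hSob`, discharged by `exists_lintegral_rpow_tenThirds_slab_le`), and the pointwise
gradient bound `LeiZhang2011.norm_gradient_mul_comp_sq_le'`. Compared with Lei–Zhang 2011 there
is no stream-function (`BMO`) term — the drift enters the energy inequality only through `C_Φ` —
and the step goes from `L¹` to `L^{5/3}` directly (exponent ratio `χ = 5/3`).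

## References

* Z. Lei, X. Ren, Q. S. Zhang, arXiv:1902.11229, §2, proof of Lemma 2.1, (2.8)–(2.10)
  (arXiv pp. 5–6). [LeiRenZhang2019]
* Z. Lei, Q. S. Zhang, J. Funct. Anal. 261 (2011) = arXiv:1011.5066, §2 (2.4)–(2.5) (the scheme;
  tree `LeiZhang2011MoserStep`). [LeiZhang2011]
-/

noncomputable section

open MeasureTheory Set Function Filter Metric intervalIntegral
open _root_.Topology
open scoped InnerProductSpace RealInnerProductSpace NNReal ENNReal Laplacian

namespace Literature.Analysis.FluidPDE

namespace LeiRenZhang2019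

open LeiZhang2011 Literature.Analysis.FunctionSpaces

/-! ### Plumbing: the period box, null faces -/

/-- Axial level sets `{x₂ = c}` are Lebesgue null in `ℝ³`. [folklore] -/
private theorem volume_setOf_apply_two_eq_pms (c : ℝ) :
    volume {x : EuclideanSpace ℝ (Fin 3) | x 2 = c} = 0 := by
  have hmp : MeasurePreserving (WithLp.ofLp : EuclideanSpace ℝ (Fin 3) → (Fin 3 → ℝ)) volume volume :=
    PiLp.volume_preserving_ofLp (Fin 3)
  have hset : {x : EuclideanSpace ℝ (Fin 3) | x 2 = c} =
      (WithLp.ofLp : EuclideanSpace ℝ (Fin 3) → (Fin 3 → ℝ)) ⁻¹' {y | y 2 = c} := rfl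
  have hmeas : MeasurableSet {y : Fin 3 → ℝ | y 2 = c} :=
    measurableSet_eq_fun (measurable_pi_apply 2) measurable_const
  rw [hset, hmp.measure_preimage hmeas.nullMeasurableSet, volume_pi]
  exact Measure.pi_hyperplane (fun _ : Fin 3 => (volume : Measure ℝ)) (2 : Fin 3) c

/-- The closed period box `[0, P] × {r ≤ ρ}` is compact. [folklore] -/
private theorem isCompact_periodBox_pms (P ρ : ℝ) :
    IsCompact {x : EuclideanSpace ℝ (Fin 3) | x 2 ∈ Icc 0 P ∧ cylRadius x ≤ ρ} := by
  have hx2 : Continuous fun x : EuclideanSpace ℝ (Fin 3) => x 2 :=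
    (EuclideanSpace.proj (𝕜 := ℝ) (2 : Fin 3)).continuous
  refine Metric.isCompact_of_isClosed_isBounded ?_ ?_
  · exact (isClosed_Icc.preimage hx2).inter (isClosed_le continuous_cylRadius continuous_const)
  · refine (Metric.isBounded_closedBall (x := (0 : EuclideanSpace ℝ (Fin 3))) (r := ρ + |P|)).subset
      fun x hx => ?_
    rw [mem_closedBall_zero_iff]
    have h := norm_le_cylRadius_add_abs_apply_two x
    have h2 : |x 2| ≤ |P| := by
      rw [abs_le]
      exact ⟨by linarith [hx.1.1, abs_nonneg P], hx.1.2.trans (le_abs_self P)⟩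
    linarith [hx.2]

/-- The period box is measurable. [folklore] -/
private theorem measurableSet_periodBox_pms (P ρ : ℝ) :
    MeasurableSet {x : EuclideanSpace ℝ (Fin 3) | x 2 ∈ Icc 0 P ∧ cylRadius x ≤ ρ} :=
  (isCompact_periodBox_pms P ρ).isClosed.measurableSet

/-- **One period slab cut by a cylinder agrees a.e. with the closed period box** (they differ
inside the face `{x₂ = P}`): the domains `D_R = {r < R} × [0, Z₀)` of Lei–Ren–Zhang may be
closed up in `z` without changing integrals. [cite: LeiRenZhang2019, §2 (the periodic domains D_R = {r<R}×[0,Z₀), P_R = D_R × (−R²,0]), arXiv p. 5] -/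
theorem zSlab_inter_cylinder_ae_eq_periodBox (P ρ : ℝ) :
    (zSlab P 0 ∩ {x | cylRadius x ≤ ρ} : Set (EuclideanSpace ℝ (Fin 3))) =ᵐ[volume]
      {x : EuclideanSpace ℝ (Fin 3) | x 2 ∈ Icc 0 P ∧ cylRadius x ≤ ρ} := by
  refine ae_eq_set.2 ⟨?_, ?_⟩
  · have h : (zSlab P 0 ∩ {x | cylRadius x ≤ ρ} : Set (EuclideanSpace ℝ (Fin 3))) \
        {x | x 2 ∈ Icc 0 P ∧ cylRadius x ≤ ρ} = ∅ := by
      refine eq_empty_of_forall_notMem fun x hx => hx.2 ⟨?_, hx.1.2⟩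
      have h1 := (mem_zSlab.1 hx.1.1)
      simp only [Int.cast_zero, zero_mul, zero_add, one_mul] at h1
      exact ⟨h1.1, h1.2.le⟩
    rw [h, measure_empty]
  · refine measure_mono_null (fun x hx => ?_) (volume_setOf_apply_two_eq_pms P)
    obtain ⟨⟨hz, hr⟩, hx⟩ := hx
    show x 2 = P
    by_contra hne
    refine hx ⟨mem_zSlab.2 ?_, hr⟩
    simp only [Int.cast_zero, zero_mul, zero_add, one_mul]
    exact ⟨hz.1, lt_of_le_of_ne hz.2 hne⟩

/-- **Integrals over one period of a function vanishing off the cylinder `{r < ρ}` are integrals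
over the closed period box.** [cite: LeiRenZhang2019, §2 (integrals over one period D_R = {r<R}×[0,Z₀)), arXiv p. 5] -/
theorem setIntegral_zSlab_eq_periodBox {P ρ : ℝ} {f : EuclideanSpace ℝ (Fin 3) → ℝ}
    (hf0 : ∀ x, ρ ≤ cylRadius x → f x = 0) :
    ∫ x in zSlab P 0, f x = ∫ x in {x | x 2 ∈ Icc 0 P ∧ cylRadius x ≤ ρ}, f x := by
  have h1 : ∫ x in zSlab P 0, f x = ∫ x in zSlab P 0 ∩ {x | cylRadius x ≤ ρ}, f x := by
    refine setIntegral_eq_of_subset_of_forall_sdiff_eq_zero (measurableSet_zSlab P 0)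
      inter_subset_left fun x hx => hf0 x ?_
    by_contra h
    exact hx.2 ⟨hx.1, (not_le.1 h).le⟩
  have h2 : ∫ x in {x | x 2 ∈ Icc 0 P ∧ cylRadius x ≤ ρ}, f x =
      ∫ x in zSlab P 0 ∩ {x | cylRadius x ≤ ρ}, f x :=
    setIntegral_congr_set (zSlab_inter_cylinder_ae_eq_periodBox P ρ).symm
  rw [h1, h2]

/-- A nonnegative `C¹` cut-off has zero gradient where it vanishes. [folklore] -/
private theorem gradient_eq_zero_of_cutoff_eq_zero_pms {ψ : EuclideanSpace ℝ (Fin 3) → ℝ}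
    (hψ0 : ∀ y, 0 ≤ ψ y) {x : EuclideanSpace ℝ (Fin 3)} (hx : ψ x = 0) : gradient ψ x = 0 := by
  have hmin : IsLocalMin ψ x := Filter.Eventually.of_forall fun y => by rw [hx]; exact hψ0 y
  rw [gradient, hmin.fderiv_eq_zero, map_zero]

/-- The final arithmetic of the Moser step per period:
`6 M C (c₁ I)^{2/3} (c₂ I) = (6 M C c₁^{2/3} c₂) I^{5/3}` in `ℝ≥0∞`. [folklore] -/
private theorem step_arith_pms {LHS M23 CS2 : ℝ≥0∞} {c₁ c₂ I Mr CSr : ℝ} (hc₁ : 0 ≤ c₁) (hc₂ : 0 ≤ c₂)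
    (hI : 0 ≤ I) (hMr : 0 ≤ Mr) (hCSr : 0 ≤ CSr) (hM : M23 = ENNReal.ofReal Mr)
    (hCS : CS2 = ENNReal.ofReal CSr)
    (h : LHS ≤ 6 * M23 * CS2 * ENNReal.ofReal (c₁ * I) ^ (2 / 3 : ℝ) * ENNReal.ofReal (c₂ * I)) :
    LHS ≤ ENNReal.ofReal (6 * Mr * CSr * (c₁ ^ (2 / 3 : ℝ) * c₂)) * ENNReal.ofReal I ^ (5 / 3 : ℝ) := by
  refine h.trans (le_of_eq ?_)
  have e6 : (6 : ℝ≥0∞) = ENNReal.ofReal 6 := by norm_num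
  rw [hM, hCS, ENNReal.ofReal_rpow_of_nonneg (mul_nonneg hc₁ hI) (by norm_num),
    ENNReal.ofReal_rpow_of_nonneg hI (by norm_num), e6,
    ← ENNReal.ofReal_mul (by norm_num), ← ENNReal.ofReal_mul (by positivity),
    ← ENNReal.ofReal_mul (by positivity), ← ENNReal.ofReal_mul (by positivity),
    ← ENNReal.ofReal_mul (by positivity)]
  congr 1
  rw [Real.mul_rpow hc₁ hI, show (5 / 3 : ℝ) = 2 / 3 + 1 by norm_num,
    Real.rpow_add_of_nonneg hI (by norm_num) (by norm_num), Real.rpow_one]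
  ring

/-! ### One Moser step per period -/

/-- **One step of Moser's iteration per period (Lei–Ren–Zhang 2019, proof of Lemma 2.1,
(2.8)–(2.10)).** See the module docstring for the setting and the constant. Hypotheses: the data
of `energy_inequality_periodic` on `[−T₁, 0]` (axisymmetric periodic `F ∈ C²` vanishing on the
axis, the `C¹` divergence-free periodic drift with its angular-stream potential `Φ`,
`|Φ| ≤ C_Φ r`, the time-integrated equation, the space–time integrability of the tested equation,
the slab functionals integrable in time), a convex `H ∈ C²` with `H(0) = 0`, `H'² ≤ κHH″`,
`κ ≥ 1`, a `C¹` square root `s_H` (`s_H² = H`, `2s_H'² ≤ H″`), the `z`-independent radial cut-off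
`ψ` (`= 1` on `{r ≤ r₂}`, `= 0` off `{r < r₁}`, `‖∇ψ‖ ≤ D`) and time cut-off `η` (`= 1` on
`[−T₂, 0]`, `η(−T₁) = 0`, `|η'| ≤ D'`), `H(F)` jointly continuous, and the slab interpolation
inequality `hSob` with `M` periods and constant `C₀`. [cite: LeiRenZhang2019, §2, proof of Lemma 2.1, (2.8)–(2.10) (arXiv pp. 5–6)] -/
theorem reverse_holder_step_periodic
    {P : ℝ} (hP : 0 < P) {Mw : ℕ} {C₀ : ℝ}
    (hSob : ∀ ⦃g : ℝ → EuclideanSpace ℝ (Fin 3) → ℝ⦄ ⦃ν : Measure ℝ⦄ ⦃R₀ : ℝ⦄,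
      (∀ᵐ s ∂ν, ContDiff ℝ 1 (g s)) → (∀ᵐ s ∂ν, IsAxiallyPeriodic P (g s)) →
      (∀ᵐ s ∂ν, ∀ x, R₀ ≤ cylRadius x → g s x = 0) →
      ∀ ⦃Mstar : ℝ≥0∞⦄, (∀ᵐ s ∂ν, ∫⁻ x in zSlab P 0, ‖g s x‖ₑ ^ 2 ≤ Mstar) →
      ∀ ⦃W : ℝ → ℝ≥0∞⦄, AEMeasurable W ν →
      (∀ᵐ s ∂ν, (∫⁻ x in zSlab P 0, ‖fderiv ℝ (g s) x‖ₑ ^ 2) +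
          ENNReal.ofReal ((C₀ / (Mw * P)) ^ 2) * ∫⁻ x in zSlab P 0, ‖g s x‖ₑ ^ 2 ≤ W s) →
      ∫⁻ p, ‖g p.1 p.2‖ₑ ^ (10 / 3 : ℝ) ∂(ν.prod (volume.restrict (zSlab P 0))) ≤
        6 * (Mw : ℝ≥0∞) ^ (2 / 3 : ℝ) *
          (SNormLESNormFDerivOfEqConst ℝ (volume : Measure (EuclideanSpace ℝ (Fin 3))) 2 : ℝ≥0∞) ^ 2 *
          Mstar ^ (2 / 3 : ℝ) * ∫⁻ s, W s ∂ν)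
    {r₁ r₂ T₁ T₂ : ℝ} (hT₂ : 0 < T₂) (hT : T₂ < T₁)
    {F N : ℝ → EuclideanSpace ℝ (Fin 3) → ℝ}
    {b : ℝ → EuclideanSpace ℝ (Fin 3) → EuclideanSpace ℝ (Fin 3)}
    {Φ : ℝ → EuclideanSpace ℝ (Fin 3) → ℝ}
    (hF2 : ∀ s, ContDiff ℝ 2 (F s)) (hFa : ∀ s, IsAxisymmetricScalar (F s))
    (hF0 : ∀ s x, cylRadius x = 0 → F s x = 0) (hFp : ∀ s, IsAxiallyPeriodic P (F s))
    (hb1 : ∀ s, ContDiff ℝ 1 (b s)) (hbdiv : ∀ s x, VectorCalculus.divergence (b s) x = 0)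
    (hbp : ∀ s, IsAxiallyPeriodic P (b s))
    (hΦ1 : ∀ s, ContDiff ℝ 1 (Φ s)) (hΦp : ∀ s, IsAxiallyPeriodic P (Φ s))
    (hΦz : ∀ s x, fderiv ℝ (Φ s) x eZ = ⟪b s x, horizPart x⟫)
    {CΦ : ℝ} (hCΦ : 0 ≤ CΦ) (hΦb : ∀ s x, |Φ s x| ≤ CΦ * cylRadius x)
    (hN : ∀ s x, N s x =
      (Δ (F s)) x - fderiv ℝ (F s) x (b s x) - 2 / cylRadius x * fderiv ℝ (F s) x (eR x))
    (heq : ∀ᵐ x ∂(volume : Measure (EuclideanSpace ℝ (Fin 3))),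
      IntervalIntegrable (fun s => N s x) volume (-T₁) 0 ∧
        ∀ s ∈ Icc (-T₁) 0, F s x = F (-T₁) x + ∫ τ in (-T₁)..s, N τ x)
    -- the nonlinearity
    {H sH : ℝ → ℝ} (hH : ContDiff ℝ 2 H) (hH00 : H 0 = 0) (hH0 : ∀ v, 0 ≤ H v)
    (hH2 : ∀ v, 0 ≤ deriv (deriv H) v) {κ : ℝ} (hκ1 : 1 ≤ κ)
    (hκ : ∀ v, deriv H v ^ 2 ≤ κ * H v * deriv (deriv H) v)
    (hsH : ContDiff ℝ 1 sH) (hsH2 : ∀ v, sH v ^ 2 = H v)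
    (hsH' : ∀ v, 2 * deriv sH v ^ 2 ≤ deriv (deriv H) v)
    -- the cut-offs
    {ψ a : EuclideanSpace ℝ (Fin 3) → ℝ} (hψ : ContDiff ℝ 2 ψ) (hψa : IsAxisymmetricScalar ψ)
    (hψz : ∀ (x : EuclideanSpace ℝ (Fin 3)) (t : ℝ), ψ (x + t • eZ) = ψ x)
    (hψ1 : ∀ x, cylRadius x ≤ r₂ → ψ x = 1) (hψ0 : ∀ x, r₁ ≤ cylRadius x → ψ x = 0)
    (hψ01 : ∀ x, 0 ≤ ψ x ∧ ψ x ≤ 1) (hψr : ∀ x, ψ x * fderiv ℝ ψ x (eR x) ≤ 0)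
    (ha : ContDiff ℝ 1 a) (haz : ∀ (x : EuclideanSpace ℝ (Fin 3)) (t : ℝ), a (x + t • eZ) = a x)
    (hψg : ∀ x, gradient ψ x = a x • horizPart x) {D : ℝ} (hψD : ∀ x, ‖gradient ψ x‖ ≤ D)
    {η : ℝ → ℝ} (hη : ContDiff ℝ 1 η) (hη1 : η (-T₁) = 0) (hη2 : ∀ s, -T₂ ≤ s → η s = 1)
    (hη01 : ∀ s, 0 ≤ η s ∧ η s ≤ 1) {D' : ℝ} (hηD : ∀ s, |deriv η s| ≤ D')
    -- space–time integrability of the tested equation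
    (hint : Integrable (fun p : ℝ × EuclideanSpace ℝ (Fin 3) =>
      (deriv H (F p.1 p.2) * N p.1 p.2 * η p.1 + H (F p.1 p.2) * deriv η p.1) *
        (ψ p.2 * periodicWindow P (p.2 2)) ^ 2)
      ((volume.restrict (Ioc (-T₁) 0)).prod volume))
    -- the slab functionals on `[−T₁, 0]`
    {G M Pψ : ℝ → ℝ}
    (hG : ∀ s, G s = ∫ x in zSlab P 0, deriv (deriv H) (F s x) * ‖gradient (F s) x‖ ^ 2 * ψ x ^ 2)
    (hM : ∀ s, M s = ∫ x in zSlab P 0, H (F s x) * ψ x ^ 2)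
    (hPψ : ∀ s, Pψ s = ∫ x in zSlab P 0, H (F s x) * ‖gradient ψ x‖ ^ 2)
    (hGi : IntervalIntegrable G volume (-T₁) 0) (hMi : IntervalIntegrable M volume (-T₁) 0)
    (hPi : IntervalIntegrable Pψ volume (-T₁) 0)
    -- joint continuity of `H(F)`
    (hHFc : Continuous fun p : ℝ × EuclideanSpace ℝ (Fin 3) => H (F p.1 p.2)) :
    ∫⁻ p in Ioo (-T₂) 0 ×ˢ (zSlab P 0 ∩ {x | cylRadius x ≤ r₂}),
        ENNReal.ofReal (H (F p.1 p.2)) ^ (5 / 3 : ℝ) ∂((volume : Measure ℝ).prod volume) ≤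
      ENNReal.ofReal (6 * (Mw : ℝ) ^ (2 / 3 : ℝ) *
        (SNormLESNormFDerivOfEqConst ℝ (volume : Measure (EuclideanSpace ℝ (Fin 3))) 2 : ℝ) ^ 2 *
        ((4 * κ * (1 + CΦ ^ 2) * D ^ 2 + D') ^ (2 / 3 : ℝ) *
          (2 * (4 * κ * (1 + CΦ ^ 2) * D ^ 2 + D') + 2 * D ^ 2 + (C₀ / (Mw * P)) ^ 2))) *
      (∫⁻ p in Ioc (-T₁) 0 ×ˢ {x : EuclideanSpace ℝ (Fin 3) | x 2 ∈ Icc 0 P ∧ cylRadius x ≤ r₁},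
        ENNReal.ofReal (H (F p.1 p.2)) ∂((volume : Measure ℝ).prod volume)) ^ (5 / 3 : ℝ) := by
  -- ### notation and elementary facts
  set K : Set (EuclideanSpace ℝ (Fin 3)) := {x | x 2 ∈ Icc 0 P ∧ cylRadius x ≤ r₁} with hK
  have hKc : IsCompact K := isCompact_periodBox_pms P r₁
  have hT₁ : 0 < T₁ := hT₂.trans hT
  have ht₁ : -T₁ ≤ 0 := by linarith
  have hD0 : 0 ≤ D := (norm_nonneg _).trans (hψD 0)
  have hD'0 : 0 ≤ D' := (abs_nonneg _).trans (hηD 0)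
  have hκ0 : 0 ≤ κ := zero_le_one.trans hκ1
  set CS : ℝ := (SNormLESNormFDerivOfEqConst ℝ (volume : Measure (EuclideanSpace ℝ (Fin 3))) 2 : ℝ)
    with hCS
  have hCS0 : 0 ≤ CS := NNReal.coe_nonneg _
  set c₁ : ℝ := 4 * κ * (1 + CΦ ^ 2) * D ^ 2 + D' with hc₁
  have hc₁0 : 0 ≤ c₁ := by positivity
  set cw : ℝ := (C₀ / (Mw * P)) ^ 2 with hcw
  have hcw0 : 0 ≤ cw := sq_nonneg _
  set c₂ : ℝ := 2 * c₁ + 2 * D ^ 2 + cw with hc₂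
  have hc₂0 : 0 ≤ c₂ := by positivity
  -- the big-cylinder mass `A` and the majorant `Rm = c₁ A`
  set A : ℝ → ℝ := fun s => ∫ x in K, H (F s x) with hA
  have hAc : Continuous A :=
    continuous_parametric_integral_of_continuous (f := fun s x => H (F s x)) hHFc hKc
  have hA0 : ∀ s, 0 ≤ A s := fun s => integral_nonneg fun x => hH0 _
  set Rm : ℝ → ℝ := fun s => c₁ * A s with hRm
  have hRmc : Continuous Rm := continuous_const.mul hAc
  have hRm0 : ∀ s, 0 ≤ Rm s := fun s => mul_nonneg hc₁0 (hA0 s)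
  -- continuity facts
  have hHFs : ∀ s, Continuous fun x => H (F s x) := fun s => hH.continuous.comp (hF2 s).continuous
  have hgradψ : Continuous (gradient ψ) := continuous_gradient_of_contDiff (hψ.of_le one_le_two)
  have hψnn : ∀ y, 0 ≤ ψ y := fun y => (hψ01 y).1
  have hgradψ0 : ∀ x, r₁ ≤ cylRadius x → gradient ψ x = 0 := fun x hx =>
    gradient_eq_zero_of_cutoff_eq_zero_pms hψnn (hψ0 x hx)
  -- `M ≤ A`, `Pψ ≤ D² A` (slice-wise)
  have hMle : ∀ s, M s ≤ A s := by
    intro s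
    rw [hM s, setIntegral_zSlab_eq_periodBox (ρ := r₁) (fun x hx => by rw [hψ0 x hx]; ring), hA]
    refine setIntegral_mono_on (((hHFs s).mul (hψ.continuous.pow 2)).continuousOn.integrableOn_compact hKc)
      ((hHFs s).continuousOn.integrableOn_compact hKc) hKc.isClosed.measurableSet fun x _ => ?_
    have h1 : ψ x ^ 2 ≤ 1 := by have := hψ01 x; nlinarith
    calc H (F s x) * ψ x ^ 2 ≤ H (F s x) * 1 := mul_le_mul_of_nonneg_left h1 (hH0 _)
      _ = H (F s x) := mul_one _
  have hPle : ∀ s, Pψ s ≤ D ^ 2 * A s := by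
    intro s
    rw [hPψ s, setIntegral_zSlab_eq_periodBox (ρ := r₁) (fun x hx => by rw [hgradψ0 x hx, norm_zero]; ring),
      hA, ← MeasureTheory.integral_const_mul]
    refine setIntegral_mono_on (((hHFs s).mul (hgradψ.norm.pow 2)).continuousOn.integrableOn_compact hKc)
      ((continuous_const.mul (hHFs s)).continuousOn.integrableOn_compact hKc) hKc.isClosed.measurableSet
      fun x _ => ?_
    have h1 : ‖gradient ψ x‖ ^ 2 ≤ D ^ 2 := pow_le_pow_left₀ (norm_nonneg _) (hψD x) 2
    calc H (F s x) * ‖gradient ψ x‖ ^ 2 ≤ H (F s x) * D ^ 2 := mul_le_mul_of_nonneg_left h1 (hH0 _)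
      _ = D ^ 2 * H (F s x) := by ring
  have hMnn : ∀ s, 0 ≤ M s := fun s => by
    rw [hM s]
    exact setIntegral_nonneg (measurableSet_zSlab P 0) fun x _ => mul_nonneg (hH0 _) (sq_nonneg _)
  have hPnn : ∀ s, 0 ≤ Pψ s := fun s => by
    rw [hPψ s]
    exact setIntegral_nonneg (measurableSet_zSlab P 0) fun x _ => mul_nonneg (hH0 _) (sq_nonneg _)
  have hG0 : ∀ s, 0 ≤ G s := fun s => by
    rw [hG s]
    exact setIntegral_nonneg (measurableSet_zSlab P 0) fun x _ =>
      mul_nonneg (mul_nonneg (hH2 _) (sq_nonneg _)) (sq_nonneg _)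
  -- ### Step 1: the energy inequality on `[−T₁, t]` for every `t ∈ [−T₁, 0]`
  have hηc : Continuous η := hη.continuous
  have hη'c : Continuous (deriv η) := hη.continuous_deriv le_rfl
  have hEI : ∀ t ∈ Icc (-T₁) 0,
      η t * M t + 1 / 2 * ∫ s in (-T₁)..t, η s * G s ≤ ∫ s in (-T₁)..t, Rm s := by
    intro t ht
    have hsubI : Icc (-T₁) t ⊆ Icc (-T₁) 0 := Icc_subset_Icc le_rfl ht.2
    have hsub : Ioc (-T₁) t ⊆ Ioc (-T₁) 0 := Ioc_subset_Ioc le_rfl ht.2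
    have huIcc : uIcc (-T₁) t ⊆ uIcc (-T₁) 0 := by
      rw [uIcc_of_le ht.1, uIcc_of_le ht₁]; exact hsubI
    have heq_t : ∀ᵐ x ∂(volume : Measure (EuclideanSpace ℝ (Fin 3))),
        IntervalIntegrable (fun s => N s x) volume (-T₁) t ∧
          ∀ s ∈ Icc (-T₁) t, F s x = F (-T₁) x + ∫ τ in (-T₁)..s, N τ x := by
      filter_upwards [heq] with x hx
      exact ⟨hx.1.mono_set huIcc, fun s hs => hx.2 s (hsubI hs)⟩
    have hint_t : Integrable (fun p : ℝ × EuclideanSpace ℝ (Fin 3) =>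
        (deriv H (F p.1 p.2) * N p.1 p.2 * η p.1 + H (F p.1 p.2) * deriv η p.1) *
          (ψ p.2 * periodicWindow P (p.2 2)) ^ 2)
        ((volume.restrict (Ioc (-T₁) t)).prod volume) :=
      hint.mono_measure (Measure.prod_mono (Measure.restrict_mono hsub le_rfl) le_rfl)
    have h := energy_inequality_periodic (t₁ := -T₁) (t₂ := t) ht.1 hP hF2 hFa hF0 hFp hb1 hbdiv hbp
      hΦ1 hΦp hΦz hCΦ hΦb hN heq_t hH hH00 hH0 hH2 hκ0 hκ hψ hψa hψz hψ0 hψr ha haz hψg hη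
      (fun s _ => (hη01 s).1) hη1 (ε := 1 / 4) (by norm_num) hint_t hG hM hPψ
      (hGi.mono_set huIcc) (hMi.mono_set huIcc) (hPi.mono_set huIcc)
    have e : (1 : ℝ) - 2 * (1 / 4) = 1 / 2 := by norm_num
    rw [e] at h
    -- the right-hand side is dominated by `∫ Rm`
    have hRle : ∫ s in (-T₁)..t, (η s * (κ / (1 / 4) * (1 + CΦ ^ 2)) * Pψ s + |deriv η s| * M s) ≤
        ∫ s in (-T₁)..t, Rm s := by
      have hli : IntervalIntegrable (fun s => η s * (κ / (1 / 4) * (1 + CΦ ^ 2)) * Pψ s + |deriv η s| * M s)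
          volume (-T₁) t := by
        have h1 : IntervalIntegrable (fun s => η s * (κ / (1 / 4) * (1 + CΦ ^ 2)) * Pψ s) volume (-T₁) t :=
          (((hPi.mono_set huIcc).continuousOn_mul hηc.continuousOn).const_mul
            (κ / (1 / 4) * (1 + CΦ ^ 2))).congr_ae (Eventually.of_forall fun s => by ring)
        exact h1.add ((hMi.mono_set huIcc).continuousOn_mul hη'c.abs.continuousOn)
      refine intervalIntegral.integral_mono_on ht.1 hli (hRmc.intervalIntegrable _ _) fun s _ => ?_
      have hηs := hη01 s
      have hP1 := hPle s
      have hM1 := hMle s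
      have h1 : η s * (κ / (1 / 4) * (1 + CΦ ^ 2)) * Pψ s ≤ 4 * κ * (1 + CΦ ^ 2) * D ^ 2 * A s := by
        have h2 : η s * (κ / (1 / 4) * (1 + CΦ ^ 2)) ≤ 4 * κ * (1 + CΦ ^ 2) := by
          rw [show κ / (1 / 4) * (1 + CΦ ^ 2) = 4 * κ * (1 + CΦ ^ 2) by ring]
          exact mul_le_of_le_one_left (by positivity) hηs.2
        calc η s * (κ / (1 / 4) * (1 + CΦ ^ 2)) * Pψ s ≤ 4 * κ * (1 + CΦ ^ 2) * Pψ s :=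
              mul_le_mul_of_nonneg_right h2 (hPnn s)
          _ ≤ 4 * κ * (1 + CΦ ^ 2) * (D ^ 2 * A s) := mul_le_mul_of_nonneg_left hP1 (by positivity)
          _ = 4 * κ * (1 + CΦ ^ 2) * D ^ 2 * A s := by ring
      have h3 : |deriv η s| * M s ≤ D' * A s := mul_le_mul (hηD s) hM1 (hMnn s) hD'0
      calc η s * (κ / (1 / 4) * (1 + CΦ ^ 2)) * Pψ s + |deriv η s| * M s
          ≤ 4 * κ * (1 + CΦ ^ 2) * D ^ 2 * A s + D' * A s := add_le_add h1 h3
        _ = Rm s := by simp only [hRm, hc₁]; ring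
    exact h.trans hRle
  -- ### Step 2: `sup M ≤ ℛ`, `∫ G ≤ 2ℛ`
  set ℛ : ℝ := ∫ s in (-T₁)..0, Rm s with hℛ
  obtain ⟨hMsup, hGint⟩ := sup_le_and_integral_le_of_energy_ineq (t₁ := -T₁) (T₂ := T₂)
    (by linarith) hT₂.le hEI (fun s => (hη01 s).1) (fun s hs => hη2 s hs.1) hMnn
    (fun s _ => hG0 s) (fun s _ => hRm0 s) (hGi.continuousOn_mul hηc.continuousOn)
    (hRmc.intervalIntegrable _ _)
  have hℛ0 : 0 ≤ ℛ := intervalIntegral.integral_nonneg ht₁ fun s _ => hRm0 s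
  set I : ℝ := ∫ s in (-T₁)..0, A s with hI
  have hI0 : 0 ≤ I := intervalIntegral.integral_nonneg ht₁ fun s _ => hA0 s
  have hℛI : ℛ = c₁ * I := by
    simp only [hℛ, hRm, hI, intervalIntegral.integral_const_mul]
  -- ### Step 3: the slab interpolation inequality on `ν = vol|(−T₂, 0)`
  set ν : Measure ℝ := volume.restrict (Ioo (-T₂) 0) with hν
  have hIooI : Ioo (-T₂) (0 : ℝ) ⊆ Icc (-T₂) 0 := Ioo_subset_Icc_self
  have hsub₂ : uIcc (-T₂) 0 ⊆ uIcc (-T₁) 0 := by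
    rw [uIcc_of_le (by linarith : -T₂ ≤ (0:ℝ)), uIcc_of_le ht₁]
    exact Icc_subset_Icc (by linarith) le_rfl
  -- the functions `g(s) = ψ · s_H(F(s))`
  obtain ⟨g, hg⟩ : ∃ g : ℝ → EuclideanSpace ℝ (Fin 3) → ℝ, ∀ s, g s = fun x => ψ x * sH (F s x) :=
    ⟨_, fun _ => rfl⟩
  have hψ1C : ContDiff ℝ 1 ψ := hψ.of_le one_le_two
  have hgC : ∀ s, ContDiff ℝ 1 (g s) := fun s => by
    rw [hg s]; exact hψ1C.mul (hsH.comp ((hF2 s).of_le one_le_two))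
  have hgcont : ∀ s, Continuous (g s) := fun s => (hgC s).continuous
  have hψp : IsAxiallyPeriodic P ψ := fun x => hψz x P
  have hgp : ∀ s, IsAxiallyPeriodic P (g s) := fun s => by
    rw [hg s]
    intro x
    have h1 : ψ (x + P • EuclideanSpace.single (2 : Fin 3) (1 : ℝ)) = ψ x := hψp x
    have h2 : F s (x + P • EuclideanSpace.single (2 : Fin 3) (1 : ℝ)) = F s x := hFp s x
    simp only [h1, h2]
  have hg0 : ∀ s x, r₁ ≤ cylRadius x → g s x = 0 := fun s x hx => by
    rw [hg s]; simp only [hψ0 x hx, zero_mul]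
  have hg2 : ∀ s x, g s x ^ 2 = H (F s x) * ψ x ^ 2 := fun s x => by
    rw [hg s]; simp only [mul_pow, hsH2]; ring
  -- slab `L²` mass of `g(s)` is `M(s)`
  have hgsq_int : ∀ s, IntegrableOn (fun x => g s x ^ 2) (zSlab P 0) volume := fun s =>
    integrableOn_zSlab_of_eq_zero_of_le_cylRadius (Q := fun x => g s x ^ 2) ((hgcont s).pow 2)
      (fun x hx => by show g s x ^ 2 = 0; rw [hg0 s x hx]; ring) P 0
  have hgL2 : ∀ s, ∫⁻ x in zSlab P 0, ‖g s x‖ₑ ^ 2 = ENNReal.ofReal (M s) := by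
    intro s
    rw [hM s]
    have h1 : ∫ x in zSlab P 0, H (F s x) * ψ x ^ 2 = ∫ x in zSlab P 0, g s x ^ 2 :=
      setIntegral_congr_fun (measurableSet_zSlab P 0) fun x _ => (hg2 s x).symm
    rw [h1, ofReal_integral_eq_lintegral_ofReal (hgsq_int s) (ae_of_all _ fun x => sq_nonneg _)]
    refine lintegral_congr fun x => ?_
    rw [Real.enorm_eq_ofReal_abs, ← ENNReal.ofReal_pow (abs_nonneg _), sq_abs]
  have hM_ae : ∀ᵐ s ∂ν, ∫⁻ x in zSlab P 0, ‖g s x‖ₑ ^ 2 ≤ ENNReal.ofReal ℛ := by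
    refine (ae_restrict_iff' measurableSet_Ioo).2 (ae_of_all _ fun s hs => ?_)
    rw [hgL2 s]
    exact ENNReal.ofReal_le_ofReal (hMsup s (hIooI hs))
  -- the slice gradient bound `∫_{slab} ‖∇g‖² ≤ G + 2Pψ`
  set W : ℝ → ℝ≥0∞ := fun s => ENNReal.ofReal (G s + 2 * Pψ s + cw * M s) with hW
  have hWm : AEMeasurable W ν := by
    have hGm : AEStronglyMeasurable G ν :=
      (hGi.mono_set hsub₂).1.aestronglyMeasurable.mono_measure
        (Measure.restrict_mono Ioo_subset_Ioc_self le_rfl)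
    have hPm : AEStronglyMeasurable Pψ ν :=
      (hPi.mono_set hsub₂).1.aestronglyMeasurable.mono_measure
        (Measure.restrict_mono Ioo_subset_Ioc_self le_rfl)
    have hMm : AEStronglyMeasurable M ν :=
      (hMi.mono_set hsub₂).1.aestronglyMeasurable.mono_measure
        (Measure.restrict_mono Ioo_subset_Ioc_self le_rfl)
    exact ENNReal.measurable_ofReal.comp_aemeasurable
      ((hGm.aemeasurable.add (hPm.aemeasurable.const_mul 2)).add (hMm.aemeasurable.const_mul cw))
  have hH'' : Continuous (deriv (deriv H)) := by
    have h2 : ContDiff ℝ (1 + 1) H := by rw [one_add_one_eq_two]; exact hH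
    exact h2.deriv'.continuous_deriv le_rfl
  have hW_ae : ∀ᵐ s ∂ν, (∫⁻ x in zSlab P 0, ‖fderiv ℝ (g s) x‖ₑ ^ 2) +
      ENNReal.ofReal ((C₀ / (Mw * P)) ^ 2) * ∫⁻ x in zSlab P 0, ‖g s x‖ₑ ^ 2 ≤ W s := by
    refine ae_of_all _ fun s => ?_
    -- the pointwise bound and its slab integral
    set w : EuclideanSpace ℝ (Fin 3) → ℝ := fun x =>
      deriv (deriv H) (F s x) * ‖gradient (F s) x‖ ^ 2 * ψ x ^ 2 + 2 * H (F s x) * ‖gradient ψ x‖ ^ 2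
      with hw
    have hF1 : ContDiff ℝ 1 (F s) := (hF2 s).of_le one_le_two
    have hgradF : Continuous (gradient (F s)) := continuous_gradient_of_contDiff hF1
    have hwc : Continuous w :=
      (((hH''.comp (hF2 s).continuous).mul (hgradF.norm.pow 2)).mul (hψ.continuous.pow 2)).add
        ((continuous_const.mul (hHFs s)).mul (hgradψ.norm.pow 2))
    have hw0' : ∀ x, r₁ ≤ cylRadius x → w x = 0 := fun x hx => by
      simp only [hw, hψ0 x hx, hgradψ0 x hx, norm_zero]; ring
    have hwi : IntegrableOn w (zSlab P 0) volume :=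
      integrableOn_zSlab_of_eq_zero_of_le_cylRadius hwc hw0' P 0
    have hw0 : ∀ x, 0 ≤ w x := fun x =>
      add_nonneg (mul_nonneg (mul_nonneg (hH2 _) (sq_nonneg _)) (sq_nonneg _))
        (mul_nonneg (mul_nonneg zero_le_two (hH0 _)) (sq_nonneg _))
    have hpt : ∀ x, ‖fderiv ℝ (g s) x‖ ^ 2 ≤ w x := fun x => by
      rw [← norm_gradient_eq_norm_fderiv, hg s]
      have h := norm_gradient_mul_comp_sq_le' hF1 hsH hsH' hψ1C x
      simp only [hw, hsH2] at h ⊢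
      linarith
    have hgrad_le : ∫⁻ x in zSlab P 0, ‖fderiv ℝ (g s) x‖ₑ ^ 2 ≤ ENNReal.ofReal (G s + 2 * Pψ s) := by
      calc ∫⁻ x in zSlab P 0, ‖fderiv ℝ (g s) x‖ₑ ^ 2
          ≤ ∫⁻ x in zSlab P 0, ENNReal.ofReal (w x) := by
            refine lintegral_mono fun x => ?_
            rw [← ofReal_norm, ← ENNReal.ofReal_pow (norm_nonneg _)]
            exact ENNReal.ofReal_le_ofReal (hpt x)
        _ = ENNReal.ofReal (∫ x in zSlab P 0, w x) :=
            (ofReal_integral_eq_lintegral_ofReal hwi (ae_of_all _ hw0)).symm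
        _ = ENNReal.ofReal (G s + 2 * Pψ s) := by
            congr 1
            rw [hG s, hPψ s, ← MeasureTheory.integral_const_mul]
            have hi1 : IntegrableOn (fun x => deriv (deriv H) (F s x) * ‖gradient (F s) x‖ ^ 2 * ψ x ^ 2)
                (zSlab P 0) volume :=
              integrableOn_zSlab_of_eq_zero_of_le_cylRadius
                (Q := fun x => deriv (deriv H) (F s x) * ‖gradient (F s) x‖ ^ 2 * ψ x ^ 2)
                (((hH''.comp (hF2 s).continuous).mul (hgradF.norm.pow 2)).mul (hψ.continuous.pow 2))
                (fun x hx => by show deriv (deriv H) (F s x) * ‖gradient (F s) x‖ ^ 2 * ψ x ^ 2 = 0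
                                rw [hψ0 x hx]; ring) P 0
            have hi2 : IntegrableOn (fun x => 2 * (H (F s x) * ‖gradient ψ x‖ ^ 2)) (zSlab P 0) volume :=
              integrableOn_zSlab_of_eq_zero_of_le_cylRadius
                (Q := fun x => 2 * (H (F s x) * ‖gradient ψ x‖ ^ 2))
                (continuous_const.mul ((hHFs s).mul (hgradψ.norm.pow 2)))
                (fun x hx => by show 2 * (H (F s x) * ‖gradient ψ x‖ ^ 2) = 0
                                rw [hgradψ0 x hx, norm_zero]; ring) P 0
            rw [← integral_add hi1 hi2]
            refine integral_congr_ae (ae_of_all _ fun x => ?_)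
            simp only [hw]
            ring
    calc (∫⁻ x in zSlab P 0, ‖fderiv ℝ (g s) x‖ₑ ^ 2) +
          ENNReal.ofReal ((C₀ / (Mw * P)) ^ 2) * ∫⁻ x in zSlab P 0, ‖g s x‖ₑ ^ 2
        ≤ ENNReal.ofReal (G s + 2 * Pψ s) + ENNReal.ofReal ((C₀ / (Mw * P)) ^ 2) * ENNReal.ofReal (M s) := by
          rw [hgL2 s]; exact add_le_add hgrad_le le_rfl
      _ = W s := by
          rw [hW, ← ENNReal.ofReal_mul hcw0, ← ENNReal.ofReal_add
            (add_nonneg (hG0 s) (mul_nonneg zero_le_two (hPnn s))) (mul_nonneg hcw0 (hMnn s))]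
  have hSobApp := hSob (ν := ν) (R₀ := r₁) (ae_of_all _ hgC) (ae_of_all _ hgp) (ae_of_all _ hg0)
    hM_ae hWm hW_ae
  -- ### Step 4: `∫ W dν ≤ c₂ I`
  have hGi₂ : IntervalIntegrable G volume (-T₂) 0 := hGi.mono_set hsub₂
  have hPi₂ : IntervalIntegrable Pψ volume (-T₂) 0 := hPi.mono_set hsub₂
  have hMi₂ : IntervalIntegrable M volume (-T₂) 0 := hMi.mono_set hsub₂
  have hPint : ∫ s in (-T₂)..0, Pψ s ≤ D ^ 2 * I := by
    have h1 : ∫ s in (-T₂)..0, Pψ s ≤ ∫ s in (-T₁)..0, Pψ s :=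
      integral_mono_interval (by linarith) (by linarith) le_rfl (ae_of_all _ hPnn) hPi
    have h2 : ∫ s in (-T₁)..0, Pψ s ≤ ∫ s in (-T₁)..0, D ^ 2 * A s :=
      intervalIntegral.integral_mono_on ht₁ hPi ((hAc.intervalIntegrable _ _).const_mul _) fun s _ => hPle s
    rw [intervalIntegral.integral_const_mul] at h2
    linarith
  have hMint : ∫ s in (-T₂)..0, M s ≤ I := by
    have h1 : ∫ s in (-T₂)..0, M s ≤ ∫ s in (-T₁)..0, M s :=
      integral_mono_interval (by linarith) (by linarith) le_rfl (ae_of_all _ hMnn) hMi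
    have h2 : ∫ s in (-T₁)..0, M s ≤ ∫ s in (-T₁)..0, A s :=
      intervalIntegral.integral_mono_on ht₁ hMi (hAc.intervalIntegrable _ _) fun s _ => hMle s
    linarith
  have hWint : ∫ s in (-T₂)..0, (G s + 2 * Pψ s + cw * M s) ≤ c₂ * I := by
    rw [intervalIntegral.integral_add (hGi₂.add (hPi₂.const_mul 2)) (hMi₂.const_mul cw),
      intervalIntegral.integral_add hGi₂ (hPi₂.const_mul 2), intervalIntegral.integral_const_mul,
      intervalIntegral.integral_const_mul]
    have : 2 * ℛ = 2 * c₁ * I := by rw [hℛI]; ring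
    simp only [hc₂]
    nlinarith [hGint, hPint, hMint, hcw0, hI0]
  have hW0 : ∀ s, 0 ≤ G s + 2 * Pψ s + cw * M s := fun s =>
    add_nonneg (add_nonneg (hG0 s) (mul_nonneg zero_le_two (hPnn s))) (mul_nonneg hcw0 (hMnn s))
  have hWlint : ∫⁻ s, W s ∂ν ≤ ENNReal.ofReal (c₂ * I) := by
    have hWi : IntegrableOn (fun s => G s + 2 * Pψ s + cw * M s) (Ioo (-T₂) 0) volume :=
      ((hGi₂.add (hPi₂.const_mul 2)).add (hMi₂.const_mul cw)).1.mono_set Ioo_subset_Ioc_self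
    rw [hν, hW, ← ofReal_integral_eq_lintegral_ofReal hWi (ae_of_all _ hW0)]
    refine ENNReal.ofReal_le_ofReal ?_
    rw [integral_Ioc_eq_integral_Ioo.symm, ← intervalIntegral.integral_of_le (by linarith : -T₂ ≤ (0:ℝ))]
    exact hWint
  -- ### Step 5: the left-hand side is dominated by `∬ ‖g‖^{10/3}`
  have hLHS : ∫⁻ p in Ioo (-T₂) 0 ×ˢ (zSlab P 0 ∩ {x | cylRadius x ≤ r₂}),
        ENNReal.ofReal (H (F p.1 p.2)) ^ (5 / 3 : ℝ) ∂((volume : Measure ℝ).prod volume) ≤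
      ∫⁻ p, ‖g p.1 p.2‖ₑ ^ (10 / 3 : ℝ) ∂(ν.prod (volume.restrict (zSlab P 0))) := by
    have e1 : ((volume : Measure ℝ).prod (volume : Measure (EuclideanSpace ℝ (Fin 3)))).restrict
        (Ioo (-T₂) 0 ×ˢ (zSlab P 0 ∩ {x | cylRadius x ≤ r₂})) =
        (ν.prod (volume.restrict (zSlab P 0))).restrict (univ ×ˢ {x | cylRadius x ≤ r₂}) := by
      rw [hν, Measure.prod_restrict,
        Measure.restrict_restrict (MeasurableSet.univ.prod
          (isClosed_le continuous_cylRadius continuous_const).measurableSet),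
        Set.prod_inter_prod, Set.univ_inter, Set.inter_comm]
    calc ∫⁻ p in Ioo (-T₂) 0 ×ˢ (zSlab P 0 ∩ {x | cylRadius x ≤ r₂}),
          ENNReal.ofReal (H (F p.1 p.2)) ^ (5 / 3 : ℝ) ∂((volume : Measure ℝ).prod volume)
        = ∫⁻ p in univ ×ˢ {x : EuclideanSpace ℝ (Fin 3) | cylRadius x ≤ r₂},
            ENNReal.ofReal (H (F p.1 p.2)) ^ (5 / 3 : ℝ) ∂(ν.prod (volume.restrict (zSlab P 0))) := by
          rw [← e1]
      _ = ∫⁻ p in univ ×ˢ {x : EuclideanSpace ℝ (Fin 3) | cylRadius x ≤ r₂},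
            ‖g p.1 p.2‖ₑ ^ (10 / 3 : ℝ) ∂(ν.prod (volume.restrict (zSlab P 0))) := by
          refine setLIntegral_congr_fun (MeasurableSet.univ.prod
            (isClosed_le continuous_cylRadius continuous_const).measurableSet) fun p hp => ?_
          have hx : cylRadius p.2 ≤ r₂ := hp.2
          rw [hg p.1]
          simp only [hψ1 p.2 hx, one_mul, Real.enorm_eq_ofReal_abs, ofReal_abs_rpow_tenThirds, hsH2]
      _ ≤ _ := setLIntegral_le_lintegral _ _
  -- ### Step 6: the right-hand side integral is `ofReal I`
  have hIlint : ENNReal.ofReal I = ∫⁻ p in Ioc (-T₁) 0 ×ˢ K,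
      ENNReal.ofReal (H (F p.1 p.2)) ∂((volume : Measure ℝ).prod volume) := by
    rw [hI]
    exact ofReal_intervalIntegral_setIntegral_eq_lintegral_prod (f := fun s x => H (F s x)) hHFc
      (fun s x => hH0 _) hKc ht₁
  -- ### Step 7: assemble
  have hmain : ∫⁻ p in Ioo (-T₂) 0 ×ˢ (zSlab P 0 ∩ {x | cylRadius x ≤ r₂}),
        ENNReal.ofReal (H (F p.1 p.2)) ^ (5 / 3 : ℝ) ∂((volume : Measure ℝ).prod volume) ≤
      6 * (Mw : ℝ≥0∞) ^ (2 / 3 : ℝ) *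
        (SNormLESNormFDerivOfEqConst ℝ (volume : Measure (EuclideanSpace ℝ (Fin 3))) 2 : ℝ≥0∞) ^ 2 *
        ENNReal.ofReal ℛ ^ (2 / 3 : ℝ) * ENNReal.ofReal (c₂ * I) :=
    hLHS.trans (hSobApp.trans (by gcongr))
  rw [hℛI] at hmain
  rw [← hIlint]
  have eM : (Mw : ℝ≥0∞) ^ (2 / 3 : ℝ) = ENNReal.ofReal ((Mw : ℝ) ^ (2 / 3 : ℝ)) := by
    rw [← ENNReal.ofReal_rpow_of_nonneg (Nat.cast_nonneg _) (by norm_num), ENNReal.ofReal_natCast]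
  have eC : (SNormLESNormFDerivOfEqConst ℝ (volume : Measure (EuclideanSpace ℝ (Fin 3))) 2 : ℝ≥0∞) ^ 2 =
      ENNReal.ofReal (CS ^ 2) := by
    rw [hCS, ENNReal.ofReal_pow (NNReal.coe_nonneg _), ENNReal.ofReal_coe_nnreal]
  exact step_arith_pms (Mr := (Mw : ℝ) ^ (2 / 3 : ℝ)) (CSr := CS ^ 2) hc₁0 hc₂0 hI0 (by positivity)
    (by positivity) eM eC hmain

end LeiRenZhang2019

end Literature.Analysis.FluidPDE

end
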